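import Summits.HubbardSuperconductivity.HubbardSuperconductivity.Theorems.AnisotropyChordTransferFibre3Hole2Range36
import Summits.HubbardSuperconductivity.HubbardSuperconductivity.Theorems.AnisotropyChordTransferFibre3Hole2Chan
import Summits.HubbardSuperconductivity.HubbardSuperconductivity.Theorems.AnisotropyChordTransferFibre3Hole2ChanL37
import Summits.HubbardSuperconductivity.HubbardSuperconductivity.Theorems.AnisotropyChordTransferFibre3Hole2ChanL46
import Summits.HubbardSuperconductivity.HubbardSuperconductivity.Theorems.AnisotropyChordTransferFibre3Hole2ChanL55
import Summits.HubbardSuperconductivity.HubbardSuperconductivity.Theorems.AnisotropyChordTransferFibre3Hole2Large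
import Summits.HubbardSuperconductivity.HubbardSuperconductivity.Theorems.AnisotropyChordTransferFibre3Hole2GM3FinRange

/-!
# Route `AnisotropyChord` / H0 rotor rung: ★★★ HOLE₂(.75) FOR EVERY `L ≥ 9` — and the GM₃ assembly without the HOLE₂ hypothesis

`TwoHoleGap L (3/4·eps1 L)` — the Poincaré inequality of the rate-½ walk on EVERY twice-punctured `L × L` torus with constant
`¾ε₁`, the one one-body spectral input of p1's GM₃ assembly `gm3_of_hole2` (via LEMMA V′, `secondGapK1OfHole75_holds`) — is a
tree theorem for EVERY `L ≥ 9` (`twoHoleGap_threeQuarter`); it is FALSE at `L = 8` (p1's `not_twoHoleGap_eight`), so the range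
is optimal.  Three regimes, one statement:
* `9 ≤ L ≤ 36`: g3's kernel interval Birman–Schwinger certificates (`…Hole2Range36.twoHoleGap_range36`);
* `37 ≤ L ≤ 63`: the per-`L` CHANNEL CHECK (three Green values, `…Hole2Chan.twoHoleGap_of_chanCheck` + kernel facts `…Hole2ChanL37/46/55`);
* `L ≥ 64`: the analytic theorem of channels (`…Hole2Large.twoHoleGap_threeQuarter_of_ge_64`: bond Birman–Schwinger + Weyl with the
  tree's ∀L window rates).
Consequences: `secondGapK1_of_ge_9` (the all-sector second gap `SecondGapK1 L (ε₁cos²θ/2)` for every `L ≥ 9`, by LEMMA V′) and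
★ `gm3_allL` = p1's `gm3_of_hole2` for every `L ≥ 9` WITHOUT the HOLE₂ hypothesis: GM₃ in the fibre follows from the three
β-free cruxes `(c, a, b)` plus — for every ground profile — `mHole ≥ 0` and the arithmetic side condition, nothing else.
Prover seat `hubbard-h0-rotor-p3` g4; helper for stmt-HubbardSuperconductivity-19089 (`--supports`, helper class).
WHAT THIS IS NOT: nothing here proves superconductivity in the Hubbard model (rotor TARGET as worded stays FALSE, g15 verdict); it
removes ONE hypothesis of ONE conditional reduction (rung 19089) for all `L ≥ 9`; the cruxes `TrialGapAbs`/`LowShellGFormAbs`/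
`OffPoleTailAbs`, `mHole ≥ 0` and the side condition remain hypotheses. Tree imports only; no sorry, no axioms beyond the standard three.
-/

set_option linter.dupNamespace false
set_option autoImplicit false

noncomputable section

namespace Summit.HubbardSuperconductivity.HubbardSuperconductivity.Theorems.AnisotropyChord.Transfer.Fibre3

namespace Hole2

/-- ★★★ HOLE₂(.75) FOR EVERY `L ≥ 9`: `TwoHoleGap L (3/4 * eps1 L)` (optimal: false at `L = 8`). [folklore] -/
theorem twoHoleGap_threeQuarter (L : ℕ) [NeZero L] (h9 : 9 ≤ L) : TwoHoleGap L (3 / 4 * eps1 L) := by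
  by_cases h36 : L ≤ 36
  · exact twoHoleGap_range36 L h9 h36
  by_cases h64 : 64 ≤ L
  · exact twoHoleGap_threeQuarter_of_ge_64 L h64
  have h37 : 37 ≤ L := by omega
  have h63 : L ≤ 63 := by omega
  interval_cases L
  · exact twoHoleGap_of_chanCheck 37 chanCheck_37
  · exact twoHoleGap_of_chanCheck 38 chanCheck_38
  · exact twoHoleGap_of_chanCheck 39 chanCheck_39
  · exact twoHoleGap_of_chanCheck 40 chanCheck_40
  · exact twoHoleGap_of_chanCheck 41 chanCheck_41
  · exact twoHoleGap_of_chanCheck 42 chanCheck_42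
  · exact twoHoleGap_of_chanCheck 43 chanCheck_43
  · exact twoHoleGap_of_chanCheck 44 chanCheck_44
  · exact twoHoleGap_of_chanCheck 45 chanCheck_45
  · exact twoHoleGap_of_chanCheck 46 chanCheck_46
  · exact twoHoleGap_of_chanCheck 47 chanCheck_47
  · exact twoHoleGap_of_chanCheck 48 chanCheck_48
  · exact twoHoleGap_of_chanCheck 49 chanCheck_49
  · exact twoHoleGap_of_chanCheck 50 chanCheck_50
  · exact twoHoleGap_of_chanCheck 51 chanCheck_51
  · exact twoHoleGap_of_chanCheck 52 chanCheck_52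
  · exact twoHoleGap_of_chanCheck 53 chanCheck_53
  · exact twoHoleGap_of_chanCheck 54 chanCheck_54
  · exact twoHoleGap_of_chanCheck 55 chanCheck_55
  · exact twoHoleGap_of_chanCheck 56 chanCheck_56
  · exact twoHoleGap_of_chanCheck 57 chanCheck_57
  · exact twoHoleGap_of_chanCheck 58 chanCheck_58
  · exact twoHoleGap_of_chanCheck 59 chanCheck_59
  · exact twoHoleGap_of_chanCheck 60 chanCheck_60
  · exact twoHoleGap_of_chanCheck 61 chanCheck_61
  · exact twoHoleGap_of_chanCheck 62 chanCheck_62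
  · exact twoHoleGap_of_chanCheck 63 chanCheck_63

end Hole2

/-- ★ the all-sector second gap of the `K₁` fibre, `SecondGapK1 L (ε₁cos²θ/2)`, for EVERY `L ≥ 9` (LEMMA V′ + HOLE₂(.75)). [folklore] -/
theorem secondGapK1_of_ge_9 (L : ℕ) [NeZero L] (h9 : 9 ≤ L) : SecondGapK1 L (eps1 L * cos2theta L / 2) :=
  secondGapK1OfHole75_holds L (by omega) (Hole2.twoHoleGap_threeQuarter L h9)

/-- ★★★ **GM₃ FROM THE THREE β-FREE CRUXES ALONE, EVERY `L ≥ 9`** (plus `mHole ≥ 0` and the side condition for the ground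
profile): p1's `gm3_of_hole2` with its HOLE₂(.75) hypothesis DISCHARGED by `Hole2.twoHoleGap_threeQuarter`. [folklore] -/
theorem gm3_allL (L : ℕ) [NeZero L] (h9 : 9 ≤ L) {Δ : ℝ} (hΔ0 : 0 < Δ) (hΔ1 : Δ < 1) (c a b : ℝ)
    (hreg : ∀ lam2 : ℝ, ∀ f : Tor L → ℝ, IsGroundTwoMagnon L Δ lam2 f →
      0 ≤ mHole L Δ f ∧ facMI L Δ f * etaEff L lam2 * (a + b / (2 + Real.cos (2 * Real.pi / L))) < c)
    (hKT1 : TrialGapAbs L Δ c) (hKT2a : LowShellGFormAbs L Δ a) (hKT2b : OffPoleTailAbs L Δ b) : GM3Fibre L Δ :=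
  gm3_of_hole2 L (by omega) hΔ0 hΔ1 c a b (Hole2.twoHoleGap_threeQuarter L h9) hreg hKT1 hKT2a hKT2b

end Summit.HubbardSuperconductivity.HubbardSuperconductivity.Theorems.AnisotropyChord.Transfer.Fibre3

end
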